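import Summits.BirchSwinnertonDyer.BirchSwinnertonDyer.Theorems.GenusKolyvaginAtTwoShaCardDvdPowAtTwoRTShaFiniteAtTwoRankQ
import Summits.BirchSwinnertonDyer.BirchSwinnertonDyer.Theorems.GenusKolyvaginAtTwoShaCardDvdPowAtTwoRTShaFiniteAtTwoCTQ
import Summits.BirchSwinnertonDyer.BirchSwinnertonDyer.Theorems.GenusKolyvaginAtTwoShaCardDvdPowAtTwoRTShaSelmerCount
import Summits.BirchSwinnertonDyer.Rank1Residual.X5.HeegnerIndexDoorAtTwo
import Summits.BirchSwinnertonDyer.Rank1Residual.Additive.X4RankZeroLowerKolyvaginIndexForm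
import Literature.NumberTheory.EllipticCurves.HeegnerPointFiniteIndex
import Literature.NumberTheory.EllipticCurves.MordellWeilTheoremProofs
import HarnessLib

/-!
# Route `GenusKolyvaginAtTwo`, crux U_T `ShaCardDvdPowAtTwoRT` (stmt-BirchSwinnertonDyer-23658), LINE 19 `rational_pair_descent` v1.1
# (LEAD gk2-p1 g19), stub PAIRCOUNT — (B2Q) MODULO PRINT and PAIRCOUNT ON THE CUT «`d_K = −ℓ` PRIME» MODULO KOLYVAGIN'S THEOREM B₂

Seat `bsd-line-gk2-p5` g29 (WIDTH-5 attach, cell `bsd-f1-sign2`), `--supports stmt-BirchSwinnertonDyer-23658` (helper; closes nothing).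
THEOREMS ONLY (no definition, no named fact, no `sorry`).  BSD is NOT proved by any of this; neither is U_T.  The theorems of §2–§3
are CONDITIONAL on the named Literature fact `Kolyvagin1989_theoremB_two` (Kolyvagin 1989 Izv., Theorem B_l at `l = 2`; unproved in the
tree, size XL) — «closed modulo print», exactly as the LEAD's v1.1 road states it.

WHAT.
* §0 `natCard_primaryComponent_sha_rat_two_dvd_of_exponent_of_minimalTwin_prime_onHabitat` — PAIRCOUNT on U_T's frame ∧ `d_K = −ℓ` ∧ minimal twin,
  MODULO AN EXPONENT: `(∀ x ∈ Ш(E/ℚ)[2^∞], 2^e • x = 0) → #Ш(E/ℚ)[2^∞] ∣ 2^(2e)` ((RANKQ) `…RTShaFiniteAtTwoRankQ` §3 + (CTQ) `…RTShaFiniteAtTwoCTQ`);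
  feed it any sharp-exponent theorem (gk2-p4 g22's unconditional (B2Q) `2^M₀·Ш(E/ℚ)[2^∞] = 0`, or §2 below).
* §1 `not_two_pow_succ_dvd_index_zmultiples_heegner_onHabitat` — **the Heegner-INDEX certificate on U_T's frame, UNCONDITIONAL modulo Q2**:
  for the `K`-rational Heegner point `P₀ ↦ P(1)` (`AdditiveKoly.exists_isHeegnerPoint_map_eq_derivedPoint_one`), `[E(K) : ℤP₀]` is FINITE,
  NON-ZERO and **`2^(M₀+1) ∤ [E(K) : ℤP₀]`** — from `rank E(K) = 1` (gk2-p4 g22 `mordellWeilRank_baseChange_eq_one_onHabitat`, Kolyvagin's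
  descent AT 2 in the tree), `E(K)[2] = 0`, McCallum's Lemma 5.1 bookkeeping (`Additive.exists_zsmul_eq_of_pow_dvd_index`) and the frame's
  `2^(M₀+1) ∤ P(1)`.
* §2 **`two_pow_smul_primaryComponent_sha_rat_eq_zero_of_kolyvaginB_two_onHabitat`** — (B2Q): granted `Kolyvagin1989_theoremB_two (N_E) W K`
  and `r_an(E) = 0`, **`2^M₀ · Ш(E/ℚ)[2^∞] = 0`** on U_T's frame (the X5 door `sha_two_pow_smul_eq_zero_of_kolyvaginB_two` fed with §1).
* §3 **`natCard_primaryComponent_sha_rat_two_dvd_of_kolyvaginB_two_of_minimalTwin_prime_onHabitat`** — PAIRCOUNT's conclusion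
  **`#Ш(E/ℚ)[2^∞] ∣ 4^M₀`** on U_T's frame ∧ `r_an(E) = 0` ∧ `d_K = −ℓ` prime ∧ a 2-Selmer-minimal model of the twin, GRANTED Kolyvagin's
  Theorem B₂ — §2 + (RANKQ) (`…RTShaFiniteAtTwoRankQ`) + (CTQ) (`…RTShaFiniteAtTwoCTQ`).  = LINE 19's `stub_shaRatCardDvdOfMinimalTwin` on the
  LEAD's cut R7-d, closed modulo print.
* §4 `natCard_primaryComponent_sha_two_dvd_of_kolyvaginB_two_of_sandwich_of_minimalTwin_prime_onHabitat` — LINE 19's composition on the cut: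
  U_T's conclusion `#Ш(E/K)[2^∞] ∣ 4^M₀` GRANTED `hB2` and the LEAD's SANDWICH′ in conclusion form (`#Ш(E/K)[2^∞] ∣ 2·#Ш(E/ℚ)[2^∞]`).

References: [Kolyvagin1989Izv] Thm. B_l (l = 2), pp. 475–476, §3; [McCallumLMS1991] Lemma 5.1, §5 Cor. 5.6; [GrossLMS1991] §1 Thm. 1.3, §4;
[MazurRubin2010] Cor. 3.4 (i); [SilvermanAEC2009] Thm. X.4.2, X.4.14.
-/

set_option autoImplicit false
-- the Theorems namespace of this sub repeats the summit name by design (D-0017 nested layout)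
set_option linter.dupNamespace false

noncomputable section

open scoped Classical
open scoped AddSubgroup

namespace Summit.BirchSwinnertonDyer.BirchSwinnertonDyer.Theorems.GenusExact.PlusDescent

open WeierstrassCurve NumberField IsDedekindDomain Field Literature.NumberTheory.EllipticCurves
  Literature.NumberTheory.GaloisRepresentations Literature.NumberTheory.EllipticCurves.ModularForms AddSubgroup
open Summit.BirchSwinnertonDyer.BirchSwinnertonDyer.Theses.GenusKolyvaginAtTwo (KolyvaginRelationAtTwo)
open Summit.BirchSwinnertonDyer.Rank1Residual

/-! ## §0 PAIRCOUNT on the cut, modulo an exponent (B2Q-shaped input) -/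

/-- **PAIRCOUNT on U_T's frame ∧ «`d_K = −ℓ` prime» ∧ «2-Selmer-minimal twin», MODULO THE SHARP EXPONENT (B2Q) ALONE**: if `2^e` kills
`Ш(E/ℚ)[2^∞]` then `#Ш(E/ℚ)[2^∞] ∣ 2^(2e)` ((RANKQ) §3 + (CTQ) `natCard_primaryComponent_sha_rat_two_dvd_of_exponent_of_card_sha_two_torsion_le_onHabitat`).
With Kolyvagin's Theorem B₂ at `l = 2` (`e = M₀`) this is LINE 19's `stub_shaRatCardDvdOfMinimalTwin` on the LEAD's cut R7-d.
[cite: Kolyvagin1989Izv, Thm. B₂] [cite: McCallumLMS1991, §5 Cor. 5.6] [cite: MazurRubin2010, Cor. 3.4 (i)] -/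
theorem natCard_primaryComponent_sha_rat_two_dvd_of_exponent_of_minimalTwin_prime_onHabitat (hQ2 : KolyvaginRelationAtTwo)
    (W : WeierstrassCurve ℚ) [W.IsElliptic] [W.IsGloballyMinimal] [NeZero (W.conductorNorm ℤ)] (hcm : ¬ W.HasCM)
    (hT : Odd W.tamagawaProduct) (v : HeightOneSpectrum (𝓞 ℚ)) (h2v : ((2 : ℕ) : 𝓞 ℚ) ∉ v.asIdeal)
    (hNv : ((W.conductorNorm ℤ : ℕ) : 𝓞 ℚ) ∈ v.asIdeal) (hmult : W.HasMultiplicativeReductionAt v) (hneg : W.Δ < 0)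
    (K : Type) [Field K] [NumberField K] (hIQ : IsImaginaryQuadratic K) (hodd : Odd (NumberField.discr K))
    (h3 : NumberField.discr K ≠ -3) (hHe : SatisfiesHeegnerHypothesis (W.conductorNorm ℤ) K)
    (hsq1 : ¬ IsSquare ((NumberField.discr K : ℚ) * -|W.Δ|)) (hsq2 : ¬ IsSquare ((NumberField.discr K : ℚ) * (-(2 * |W.Δ|))))
    (hρ : ∀ n : ℕ, 0 < n → W.HasSurjectiveModNGaloisRep ((2 : ℤ) ^ n))
    (Dt : ModularParametrizationData W (W.conductorNorm ℤ)) (β : ℤ) (ι : K →+* ℂ) (d₁ : KolyvaginHeegnerData Dt β ι 1) (M₀ : ℕ)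
    (hndiv : ¬ ∃ Q : (W.baseChange (ringClassField K ι 1)).toAffine.Point, ((2 ^ (M₀ + 1) : ℕ) : ℤ) • Q = d₁.derivedPoint)
    {ℓ : ℕ} [Fact ℓ.Prime] (hd : NumberField.discr K = -(ℓ : ℤ))
    (Wd : WeierstrassCurve ℚ) [Wd.IsElliptic] (hWd : ∃ C : VariableChange ℚ, C • W.quadraticTwist (NumberField.discr K : ℚ) = Wd)
    (hSel : Nat.card (Wd.selmerGroup 2) = 2)
    {e : ℕ} (hexp : ∀ x ∈ AddCommGroup.primaryComponent W.sha 2, 2 ^ e • x = 0) :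
    Nat.card (AddCommGroup.primaryComponent W.sha 2) ∣ 2 ^ (2 * e) :=
  natCard_primaryComponent_sha_rat_two_dvd_of_exponent_of_card_sha_two_torsion_le_onHabitat hQ2 W hcm hT v h2v hNv hmult hneg K hIQ hodd h3
    hHe hsq1 hsq2 hρ Dt β ι d₁ M₀ hndiv hexp (natCard_sha_two_torsion_le_four_of_minimalTwin_prime W hneg hIQ hodd hHe hd Wd hWd hSel)


/-! ## §1 The Heegner-index certificate `2^(M₀+1) ∤ [E(K) : ℤ y_K]` on U_T's frame -/

/-- **`2^(M₀+1) ∤ [E(K) : ℤP₀]` for the `K`-rational Heegner point `P₀ ↦ P(1)`, on U_T's frame (modulo Q2 only)** — together with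
`[E(K) : ℤP₀] ≠ 0`.  `rank E(K) = 1` (Kolyvagin's descent at `2`, gk2-p4 g21/g22) and Mordell–Weil make the index finite and non-zero
(`index_zmultiples_ne_zero_of_finrank_eq_one`); `E(K)` has no `2`-torsion (`ρ̄_{E,2}` onto, `K` imaginary quadratic); so `2^(M₀+1) ∣ [E(K):ℤP₀]`
would give `P₀ ∈ 2^(M₀+1) E(K)` (McCallum Lemma 5.1, `Additive.exists_zsmul_eq_of_pow_dvd_index`), contradicting `2^(M₀+1) ∤ P(1)` in
`E(K[1]) ⊇ E(K)`. [cite: McCallumLMS1991, Lemma 5.1 (p. 303)] [cite: GrossLMS1991, §1 Thm. 1.3, §4 (P_1 = y_K)] [cite: Kolyvagin1990, Thm. A] -/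
theorem not_two_pow_succ_dvd_index_zmultiples_heegner_onHabitat (hQ2 : KolyvaginRelationAtTwo)
    (W : WeierstrassCurve ℚ) [W.IsElliptic] [W.IsGloballyMinimal] [NeZero (W.conductorNorm ℤ)] (hcm : ¬ W.HasCM)
    (hT : Odd W.tamagawaProduct) (v : HeightOneSpectrum (𝓞 ℚ)) (h2v : ((2 : ℕ) : 𝓞 ℚ) ∉ v.asIdeal)
    (hNv : ((W.conductorNorm ℤ : ℕ) : 𝓞 ℚ) ∈ v.asIdeal) (hmult : W.HasMultiplicativeReductionAt v) (hneg : W.Δ < 0)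
    (K : Type) [Field K] [NumberField K] (hIQ : IsImaginaryQuadratic K) (hodd : Odd (NumberField.discr K))
    (h3 : NumberField.discr K ≠ -3) (hHe : SatisfiesHeegnerHypothesis (W.conductorNorm ℤ) K)
    (hsq1 : ¬ IsSquare ((NumberField.discr K : ℚ) * -|W.Δ|)) (hsq2 : ¬ IsSquare ((NumberField.discr K : ℚ) * (-(2 * |W.Δ|))))
    (hρ : ∀ n : ℕ, 0 < n → W.HasSurjectiveModNGaloisRep ((2 : ℤ) ^ n))
    (Dt : ModularParametrizationData W (W.conductorNorm ℤ)) (β : ℤ) (ι : K →+* ℂ) (d₁ : KolyvaginHeegnerData Dt β ι 1)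
    (hnt : ¬ IsOfFinAddOrder d₁.derivedPoint) (M₀ : ℕ)
    (hndiv : ¬ ∃ Q : (W.baseChange (ringClassField K ι 1)).toAffine.Point, ((2 ^ (M₀ + 1) : ℕ) : ℤ) • Q = d₁.derivedPoint)
    {P₀ : (W.baseChange K).toAffine.Point}
    (hP₀ : WeierstrassCurve.Affine.Point.map (W' := W) (algebraMap K (ringClassField K ι 1)).toRatAlgHom P₀ = d₁.derivedPoint) :
    (AddSubgroup.zmultiples P₀).index ≠ 0 ∧ ¬ 2 ^ (M₀ + 1) ∣ (AddSubgroup.zmultiples P₀).index := by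
  haveI hell : (W.baseChange K).IsElliptic := inferInstanceAs ((W.map (algebraMap ℚ K)).IsElliptic)
  haveI : AddGroup.FG (W.baseChange K).toAffine.Point := (W.baseChange K).addGroup_fg_point_holds
  have h2 : Module.finrank ℚ K = 2 := hIQ.1
  have hs2 : W.HasSurjectiveModNGaloisRep 2 := by simpa using hρ 1 one_pos
  -- `P₀` has infinite order
  have hP₀nt : ¬ IsOfFinAddOrder P₀ := fun h ↦ hnt (by rw [← hP₀]; exact AddMonoidHom.isOfFinAddOrder _ h)
  -- `rank E(K) = 1`, so the index is finite and non-zero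
  have hrank := mordellWeilRank_baseChange_eq_one_onHabitat hQ2 W hcm hT v h2v hNv hmult hneg K hIQ hodd h3 hHe hsq1 hsq2 hρ Dt β ι d₁ hnt
    M₀ hndiv
  have hidx : (AddSubgroup.zmultiples P₀).index ≠ 0 :=
    index_zmultiples_ne_zero_of_finrank_eq_one hP₀nt (by rw [← hrank]; rfl)
  refine ⟨hidx, fun hdvd ↦ ?_⟩
  -- no `2`-torsion in `E(K)`
  have hA : ∀ a : (W.baseChange K).toAffine.Point, ((2 : ℕ) : ℤ) • a = 0 → a = 0 := fun a ha ↦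
    EigenClassesFinite.forall_zsmul_two_pow_baseChange_eq_zero_of_hasSurjectiveModNGaloisRep_two W K h2 hs2 1 a (by simpa using ha)
  -- McCallum Lemma 5.1: `2^(M₀+1) ∣ index ⟹ P₀ ∈ 2^(M₀+1) E(K)`
  obtain ⟨Q, hQ⟩ := Additive.exists_zsmul_eq_of_pow_dvd_index Nat.prime_two hA hP₀nt hidx hdvd
  -- contradiction with `2^(M₀+1) ∤ P(1)`
  exact forall_two_pow_smul_ne_bottom_of_not_dvd_derivedPoint d₁ P₀ hP₀ le_rfl hndiv Q hQ

/-! ## §2 (B2Q) modulo print: `2^M₀ · Ш(E/ℚ)[2^∞] = 0` granted Kolyvagin's Theorem B₂ -/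

/-- **(B2Q) on U_T's frame, GRANTED Kolyvagin's Theorem B₂ (`Kolyvagin1989_theoremB_two`, named Literature fact, unproved) and `r_an(E) = 0`:
`2^M₀ • x = 0` for every `x ∈ Ш(E/ℚ)[2^∞]`.**  Kolyvagin's printed conclusion `[E(K) : ℤy_K] · Ш(E/ℚ)[2^∞] = 0` (the X5 door
`HeegnerIndexDoor.sha_two_pow_smul_eq_zero_of_kolyvaginB_two`) with the index certificate of §1 (`2^(M₀+1) ∤ [E(K) : ℤy_K]`); the four field
exclusions of Theorem B₂ are the frame's `d_K` odd (so `≠ −4, −8`) and the two non-square conditions. CONDITIONAL on `hB2`.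
[cite: Kolyvagin1989Izv, Thm. B_l (l = 2), p. 475–476] [cite: McCallumLMS1991, Lemma 5.1] -/
theorem two_pow_smul_primaryComponent_sha_rat_eq_zero_of_kolyvaginB_two_onHabitat
    (W : WeierstrassCurve ℚ) [W.IsElliptic] [W.IsGloballyMinimal] [NeZero (W.conductorNorm ℤ)]
    (K : Type) [Field K] [NumberField K] (hB2 : Kolyvagin1989_theoremB_two (W.conductorNorm ℤ) W K)
    (hQ2 : KolyvaginRelationAtTwo) (hcm : ¬ W.HasCM)
    (hT : Odd W.tamagawaProduct) (v : HeightOneSpectrum (𝓞 ℚ)) (h2v : ((2 : ℕ) : 𝓞 ℚ) ∉ v.asIdeal)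
    (hNv : ((W.conductorNorm ℤ : ℕ) : 𝓞 ℚ) ∈ v.asIdeal) (hmult : W.HasMultiplicativeReductionAt v) (hneg : W.Δ < 0)
    (hIQ : IsImaginaryQuadratic K) (hodd : Odd (NumberField.discr K))
    (h3 : NumberField.discr K ≠ -3) (hHe : SatisfiesHeegnerHypothesis (W.conductorNorm ℤ) K)
    (hsq1 : ¬ IsSquare ((NumberField.discr K : ℚ) * -|W.Δ|)) (hsq2 : ¬ IsSquare ((NumberField.discr K : ℚ) * (-(2 * |W.Δ|))))
    (hρ : ∀ n : ℕ, 0 < n → W.HasSurjectiveModNGaloisRep ((2 : ℤ) ^ n)) (hr0 : W.analyticRank = 0)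
    (Dt : ModularParametrizationData W (W.conductorNorm ℤ)) (β : ℤ) (ι : K →+* ℂ) (d₁ : KolyvaginHeegnerData Dt β ι 1)
    (hnt : ¬ IsOfFinAddOrder d₁.derivedPoint) (M₀ : ℕ)
    (hndiv : ¬ ∃ Q : (W.baseChange (ringClassField K ι 1)).toAffine.Point, ((2 ^ (M₀ + 1) : ℕ) : ℤ) • Q = d₁.derivedPoint) :
    ∀ x ∈ AddCommGroup.primaryComponent W.sha 2, 2 ^ M₀ • x = 0 := by
  -- the `K`-rational Heegner point under `P(1)`
  obtain ⟨P₀, hHP, hP₀⟩ := AdditiveKoly.exists_isHeegnerPoint_map_eq_derivedPoint_one (W := W) (K := K) (Dt := Dt) (β := β) (ι := ι)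
    hIQ hHe d₁
  have hP₀nt : ¬ IsOfFinAddOrder P₀ := fun h ↦ hnt (by rw [← hP₀]; exact AddMonoidHom.isOfFinAddOrder _ h)
  obtain ⟨-, hI⟩ := not_two_pow_succ_dvd_index_zmultiples_heegner_onHabitat hQ2 W hcm hT v h2v hNv hmult hneg K hIQ hodd h3 hHe hsq1 hsq2 hρ
    Dt β ι d₁ hnt M₀ hndiv hP₀
  -- `d_K` odd, hence `≠ −4, −8`
  have h4 : NumberField.discr K ≠ -4 := fun h ↦ by
    rw [h] at hodd
    exact (Int.not_even_iff_odd.mpr hodd) ⟨-2, by norm_num⟩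
  have h8 : NumberField.discr K ≠ -8 := fun h ↦ by
    rw [h] at hodd
    exact (Int.not_even_iff_odd.mpr hodd) ⟨-4, by norm_num⟩
  have hkill := X5.HeegnerIndexDoor.sha_two_pow_smul_eq_zero_of_kolyvaginB_two W hB2 hIQ hHe h3 h4 hHP hP₀nt hr0 hρ h8 hsq1 hsq2 hI
  intro x hx
  obtain ⟨n, hn⟩ := (AddCommGroup.mem_primaryComponent).1 hx
  exact hkill x n hn

/-! ## §3 PAIRCOUNT on the cut «`d_K = −ℓ` prime», granted Kolyvagin's Theorem B₂ -/

/-- **PAIRCOUNT `#Ш(E/ℚ)[2^∞] ∣ 4^M₀` on U_T's frame ∧ `r_an(E) = 0` ∧ «`d_K = −ℓ` prime» ∧ «2-Selmer-minimal twin», GRANTED Kolyvagin's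
Theorem B₂** (`hB2 : Kolyvagin1989_theoremB_two (N_E) W K`, named fact, unproved): (B2Q) §2 + (RANKQ) + (CTQ)
(`natCard_primaryComponent_sha_rat_two_dvd_of_exponent_of_minimalTwin_prime_onHabitat`).  This is LINE 19's `stub_shaRatCardDvdOfMinimalTwin`
on the LEAD's cut R7-d, CLOSED MODULO PRINT; unconditional discharge of `hB2` = one deep inert Kolyvagin prime per Selmer class over `ℚ`
(memo R7 §6b). [cite: Kolyvagin1989Izv, Thm. B_l (l = 2)] [cite: McCallumLMS1991, §5 Cor. 5.6] [cite: MazurRubin2010, Cor. 3.4 (i)] -/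
theorem natCard_primaryComponent_sha_rat_two_dvd_of_kolyvaginB_two_of_minimalTwin_prime_onHabitat
    (W : WeierstrassCurve ℚ) [W.IsElliptic] [W.IsGloballyMinimal] [NeZero (W.conductorNorm ℤ)]
    (K : Type) [Field K] [NumberField K] (hB2 : Kolyvagin1989_theoremB_two (W.conductorNorm ℤ) W K)
    (hQ2 : KolyvaginRelationAtTwo) (hcm : ¬ W.HasCM)
    (hT : Odd W.tamagawaProduct) (v : HeightOneSpectrum (𝓞 ℚ)) (h2v : ((2 : ℕ) : 𝓞 ℚ) ∉ v.asIdeal)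
    (hNv : ((W.conductorNorm ℤ : ℕ) : 𝓞 ℚ) ∈ v.asIdeal) (hmult : W.HasMultiplicativeReductionAt v) (hneg : W.Δ < 0)
    (hIQ : IsImaginaryQuadratic K) (hodd : Odd (NumberField.discr K))
    (h3 : NumberField.discr K ≠ -3) (hHe : SatisfiesHeegnerHypothesis (W.conductorNorm ℤ) K)
    (hsq1 : ¬ IsSquare ((NumberField.discr K : ℚ) * -|W.Δ|)) (hsq2 : ¬ IsSquare ((NumberField.discr K : ℚ) * (-(2 * |W.Δ|))))
    (hρ : ∀ n : ℕ, 0 < n → W.HasSurjectiveModNGaloisRep ((2 : ℤ) ^ n)) (hr0 : W.analyticRank = 0)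
    (Dt : ModularParametrizationData W (W.conductorNorm ℤ)) (β : ℤ) (ι : K →+* ℂ) (d₁ : KolyvaginHeegnerData Dt β ι 1)
    (hnt : ¬ IsOfFinAddOrder d₁.derivedPoint) (M₀ : ℕ)
    (hndiv : ¬ ∃ Q : (W.baseChange (ringClassField K ι 1)).toAffine.Point, ((2 ^ (M₀ + 1) : ℕ) : ℤ) • Q = d₁.derivedPoint)
    {ℓ : ℕ} [Fact ℓ.Prime] (hd : NumberField.discr K = -(ℓ : ℤ))
    (Wd : WeierstrassCurve ℚ) [Wd.IsElliptic] (hWd : ∃ C : VariableChange ℚ, C • W.quadraticTwist (NumberField.discr K : ℚ) = Wd)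
    (hSel : Nat.card (Wd.selmerGroup 2) = 2) :
    Nat.card (AddCommGroup.primaryComponent W.sha 2) ∣ 2 ^ (2 * M₀) :=
  natCard_primaryComponent_sha_rat_two_dvd_of_exponent_of_minimalTwin_prime_onHabitat hQ2 W hcm hT v h2v hNv hmult hneg K hIQ hodd h3 hHe hsq1
    hsq2 hρ Dt β ι d₁ M₀ hndiv hd Wd hWd hSel
    (two_pow_smul_primaryComponent_sha_rat_eq_zero_of_kolyvaginB_two_onHabitat W K hB2 hQ2 hcm hT v h2v hNv hmult hneg hIQ hodd h3 hHe hsq1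
      hsq2 hρ hr0 Dt β ι d₁ hnt M₀ hndiv)

/-! ## §4 U_T on the cut from Kolyvagin's Theorem B₂ and SANDWICH′ -/

/-- Arithmetic of the composition: `4^t ∣ 2 · 4^M₀ ⟹ 4^t ∣ 4^M₀`. [folklore] -/
theorem pow_two_mul_dvd_of_dvd_two_mul {t M₀ : ℕ} (h : 2 ^ (2 * t) ∣ 2 * 2 ^ (2 * M₀)) : 2 ^ (2 * t) ∣ 2 ^ (2 * M₀) := by
  rw [← pow_succ'] at h
  have hle : 2 * t ≤ 2 * M₀ + 1 := (Nat.pow_dvd_pow_iff_le_right (by norm_num)).mp h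
  exact Nat.pow_dvd_pow 2 (by omega)

/-- **U_T's conclusion `#Ш(E/K)[2^∞] ∣ 4^M₀` on the cut «`r_an(E) = 0` ∧ `d_K = −ℓ` prime ∧ 2-Selmer-minimal twin», GRANTED Kolyvagin's
Theorem B₂ (`hB2`) AND the LEAD's stub SANDWICH′ in conclusion form (`hSand : #Ш(E/K)[2^∞] ∣ 2 · #Ш(E/ℚ)[2^∞]`)** — LINE 19's composition on the
cut: PAIRCOUNT (§3) gives `#Ш(E/K)[2^∞] ∣ 2 · 4^M₀`, and `#Ш(E/K)[2^∞] = 4^t` (`…RTShaFiniteAtTwo` §4) refunds the odd bit.  CONDITIONAL on `hB2` and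
`hSand`. [cite: McCallumLMS1991, §5 Cor. 5.6] [cite: Kolyvagin1989Izv, Thm. B_l (l = 2)] [cite: Kramer1981, Thm. 1] -/
theorem natCard_primaryComponent_sha_two_dvd_of_kolyvaginB_two_of_sandwich_of_minimalTwin_prime_onHabitat
    (W : WeierstrassCurve ℚ) [W.IsElliptic] [W.IsGloballyMinimal] [NeZero (W.conductorNorm ℤ)]
    (K : Type) [Field K] [NumberField K] (hB2 : Kolyvagin1989_theoremB_two (W.conductorNorm ℤ) W K)
    (hQ2 : KolyvaginRelationAtTwo) (hcm : ¬ W.HasCM)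
    (hT : Odd W.tamagawaProduct) (v : HeightOneSpectrum (𝓞 ℚ)) (h2v : ((2 : ℕ) : 𝓞 ℚ) ∉ v.asIdeal)
    (hNv : ((W.conductorNorm ℤ : ℕ) : 𝓞 ℚ) ∈ v.asIdeal) (hmult : W.HasMultiplicativeReductionAt v) (hneg : W.Δ < 0)
    (hIQ : IsImaginaryQuadratic K) (hodd : Odd (NumberField.discr K))
    (h3 : NumberField.discr K ≠ -3) (hHe : SatisfiesHeegnerHypothesis (W.conductorNorm ℤ) K)
    (hsq1 : ¬ IsSquare ((NumberField.discr K : ℚ) * -|W.Δ|)) (hsq2 : ¬ IsSquare ((NumberField.discr K : ℚ) * (-(2 * |W.Δ|))))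
    (hρ : ∀ n : ℕ, 0 < n → W.HasSurjectiveModNGaloisRep ((2 : ℤ) ^ n)) (hr0 : W.analyticRank = 0)
    (Dt : ModularParametrizationData W (W.conductorNorm ℤ)) (β : ℤ) (ι : K →+* ℂ) (d₁ : KolyvaginHeegnerData Dt β ι 1)
    (hnt : ¬ IsOfFinAddOrder d₁.derivedPoint) (M₀ : ℕ)
    (hndiv : ¬ ∃ Q : (W.baseChange (ringClassField K ι 1)).toAffine.Point, ((2 ^ (M₀ + 1) : ℕ) : ℤ) • Q = d₁.derivedPoint)
    {ℓ : ℕ} [Fact ℓ.Prime] (hd : NumberField.discr K = -(ℓ : ℤ))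
    (Wd : WeierstrassCurve ℚ) [Wd.IsElliptic] (hWd : ∃ C : VariableChange ℚ, C • W.quadraticTwist (NumberField.discr K : ℚ) = Wd)
    (hSel : Nat.card (Wd.selmerGroup 2) = 2)
    (hSand : Nat.card (AddCommGroup.primaryComponent (W.baseChange K).sha 2) ∣ 2 * Nat.card (AddCommGroup.primaryComponent W.sha 2)) :
    Nat.card (AddCommGroup.primaryComponent (W.baseChange K).sha 2) ∣ 2 ^ (2 * M₀) := by
  have hpair := natCard_primaryComponent_sha_rat_two_dvd_of_kolyvaginB_two_of_minimalTwin_prime_onHabitat W K hB2 hQ2 hcm hT v h2v hNv hmult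
    hneg hIQ hodd h3 hHe hsq1 hsq2 hρ hr0 Dt β ι d₁ hnt M₀ hndiv hd Wd hWd hSel
  obtain ⟨t, ht⟩ := exists_natCard_primaryComponent_sha_two_eq_pow_two_mul_onHabitat hQ2 W hcm hT v h2v hNv hmult hneg K hIQ hodd h3 hHe hsq1
    hsq2 hρ Dt β ι d₁ M₀ hndiv
  rw [ht] at hSand ⊢
  exact pow_two_mul_dvd_of_dvd_two_mul (hSand.trans (Nat.mul_dvd_mul_left 2 hpair))

end Summit.BirchSwinnertonDyer.BirchSwinnertonDyer.Theorems.GenusExact.PlusDescent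

end
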